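import Summits.QuantumFields.YangMills.Theorems.UnitScaleTiltProp7SectET3BgClass
import Literature.MathematicalPhysics.QuantumFieldTheory.Balaban1983to89.B9Thm313WholeZ
import HarnessLib

/-!
# Route `UnitScaleTilt`, crux «MinimiserStabilityRegPr» (stmt-QuantumFields-19200, v10 stub EX, route (α), node N06(d = 3)) — OWNER RULING g25-№2 item (N06-3-4), OWNER 02:29:28Z (a):
# **THE (3.132)∕(3.126) COARSE-LETTER ROWS AS NAMED HYPOTHESIS SCHEMAS AT THE T³ INDEX** — `LettersRowT3` (plain species `Letters313`, the `thm313Printed_of_step` route of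
# `Prop7SectET3N06Leaves.t313_of_pins_T3`) and `LettersRowZT3` (Z species `Letters313Z`, the `_completePairMBZ` route)

Cell `ym3-torus` (HUMAN RULING D-0037, YM ladder rung R3 — NOT the Clay problem), width seat ym-ust-20520-w1 g2.  Count-neutral (`--supports stmt-QuantumFields-19200 --as helper`);
registry untouched; NOTHING of [Balaban1985BackgroundPropagators] asserted — the rows are DISPLAYED hypothesis schemas (N06 content at curved U; inhabited in the tree only at
U = 1 by the d-generic KIdx-uniform `B9Letters313AtOne{Dv,Q}` ∕ `B9LettersH{,Z}AtOne*` theorems, which instantiate here with `d := 2`).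

* `LettersRowT3 𝔬 R₀ H₀ c35 a₁ M₁ B₃ δ₃ : Prop` := `∀ i : KIdx 2 ℓ hd3 hL b₀ b₁, M₁ ≤ (geo9K i).M → ∀ α₀ > 0, (geo9K i).M·α₀ ≤ a₁ → ∀ U, (bgT3 i).Reg335 c35 α₀ U → (bgT3 i).Reg336 c35 α₀ U →
  Letters313 (𝔬 i) (R₀ i) (H₀ i) (geoOK_geo9K i) B₃ δ₃ U` — VERBATIM the binder `hletters` of `t313_of_pins_T3` (ten `HasMaj` rows for `G₀∘D_v`, `G₀∘Q*`, `R∘D_v*∘G₁(∘∇*)`,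
  `C₁ = (QG₁Q*)⁻¹`, `Q` between the block classes `𝔠⁽⁰⁾∕𝔠⁽¹⁾∕𝔠⁽²⁾`, constant `B₃`, rate `δ₃`);
* `LettersRowZT3 𝔬 R₀ H₀ wZ hwZ c35 a₁ M₁ B₃ δ₃ : Prop` — the same with `Letters313Z` (the four coarse factors through the weighted class `Z_{wZ}`, `wZ = n⁻¹` of record);
* `lettersRow_iff` (unfolding) and `t313_hletters_of_row` (the row IS the `hletters` binder — one-line projection, so (S3-b) binds ONE name).
[cite: Balaban1985BackgroundPropagators, (3.126) p.420, (3.132) p.422, (3.147)–(3.153) pp.425–426, Thm 3.13 p.426]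
-/

set_option autoImplicit false

noncomputable section

open scoped Matrix.Norms.L2Operator

namespace Summit.QuantumFields.YangMills.Theorems.Prop7SectET3Letters

open Literature.MathematicalPhysics.QuantumFieldTheory.Balaban1983to89
open Literature.MathematicalPhysics.QuantumFieldTheory.Balaban1983to89.B6KLevelCensusIndexV1 (KIdx)
open Literature.MathematicalPhysics.QuantumFieldTheory.Balaban1983to89.B9GeoNormsKLevelV1 (geo9K)
open Literature.MathematicalPhysics.QuantumFieldTheory.Balaban1983to89.B9Thm312Whole (Ops)
open Literature.MathematicalPhysics.QuantumFieldTheory.Balaban1983to89.B9Thm313Whole (Letters313)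
open Literature.MathematicalPhysics.QuantumFieldTheory.Balaban1983to89.B9Thm313WholeZ (Letters313Z)
open Summit.QuantumFields.YangMills.Theorems.Prop7SectET3Members (hd3)
open Summit.QuantumFields.YangMills.Theorems.Prop7SectET3Geometry (geoOK_geo9K)
open Summit.QuantumFields.YangMills.Theorems.Prop7SectET3BgClass (bgT3)

variable {ℓ : ℕ} {hL : Odd (ℓ + 1) ∧ 1 < ℓ + 1} {b₀ b₁ : ℝ} {X Y Z W : KIdx 2 ℓ hd3 hL b₀ b₁ → Type}
  [∀ i, Fintype (X i)] [∀ i, Fintype (Y i)] [∀ i, Fintype (Z i)] [∀ i, Fintype (W i)] [∀ i : KIdx 2 ℓ hd3 hL b₀ b₁, Fintype (geo9K i).Site]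

/-- **THE COARSE-LETTER ROW AT THE T³ INDEX, PLAIN SPECIES** (hypothesis schema, never asserted): for every member with `M ≥ M₁`, every `0 < α₀` with `Mα₀ ≤ a₁` and every background
`U` in (3.35) ∧ (3.36) with threshold `c35`, the ten printed-shape letters `Letters313 (𝔬 i) (R₀ i) (H₀ i) (geoOK_geo9K i) B₃ δ₃ U` of Thm 3.13's reduction ((3.147)∕(3.153) through
(3.132), (3.126)).  = the binder `hletters` of `Prop7SectET3N06Leaves.t313_of_pins_T3`. [cite: Balaban1985BackgroundPropagators, (3.132) p.422, (3.126) p.420, (3.153) p.426] -/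
def LettersRowT3 (𝔬 : ∀ i : KIdx 2 ℓ hd3 hL b₀ b₁, Ops (geo9K i) (bgT3 i) (X i) (Y i) (Z i) (W i)) (R₀ : KIdx 2 ℓ hd3 hL b₀ b₁ → ℝ)
    (H₀ : KIdx 2 ℓ hd3 hL b₀ b₁ → Prop) (c35 a₁ M₁ B₃ δ₃ : ℝ) : Prop :=
  ∀ i : KIdx 2 ℓ hd3 hL b₀ b₁, M₁ ≤ (geo9K i).M → ∀ α₀ : ℝ, 0 < α₀ → (geo9K i).M * α₀ ≤ a₁ →
    ∀ U : (bgT3 i).Cfg, (bgT3 i).Reg335 c35 α₀ U → (bgT3 i).Reg336 c35 α₀ U →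
      Letters313 (𝔬 i) (R₀ i) (H₀ i) (geoOK_geo9K i) B₃ δ₃ U

/-- **THE COARSE-LETTER ROW AT THE T³ INDEX, Z SPECIES** (hypothesis schema, never asserted): the same with `Letters313Z` — the four coarse factors `gQs2`, `c1_2`, `gQs1`, `c1_1` read
through the weighted class `Z_{wZ}` (`wZ = n⁻¹` of record), as the complete pair leaf `thm313Printed_completePairMBZ` binds them. [cite: Balaban1985BackgroundPropagators, (3.132) p.422, (3.126) p.420, p.398 (remark after (3.47))] -/
def LettersRowZT3 (𝔬 : ∀ i : KIdx 2 ℓ hd3 hL b₀ b₁, Ops (geo9K i) (bgT3 i) (X i) (Y i) (Z i) (W i)) (R₀ : KIdx 2 ℓ hd3 hL b₀ b₁ → ℝ)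
    (H₀ : KIdx 2 ℓ hd3 hL b₀ b₁ → Prop) (wZ : ∀ i : KIdx 2 ℓ hd3 hL b₀ b₁, (geo9K i).Site → ℝ) (hwZ : ∀ i y, 0 < wZ i y) (c35 a₁ M₁ B₃ δ₃ : ℝ) : Prop :=
  ∀ i : KIdx 2 ℓ hd3 hL b₀ b₁, M₁ ≤ (geo9K i).M → ∀ α₀ : ℝ, 0 < α₀ → (geo9K i).M * α₀ ≤ a₁ →
    ∀ U : (bgT3 i).Cfg, (bgT3 i).Reg335 c35 α₀ U → (bgT3 i).Reg336 c35 α₀ U →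
      Letters313Z (𝔬 i) (R₀ i) (H₀ i) (geoOK_geo9K i) (wZ i) (hwZ i) B₃ δ₃ U

/-- The plain row, unfolded. [cite: Balaban1985BackgroundPropagators, (3.132) p.422 (bookkeeping)] -/
theorem lettersRowT3_iff (𝔬 : ∀ i : KIdx 2 ℓ hd3 hL b₀ b₁, Ops (geo9K i) (bgT3 i) (X i) (Y i) (Z i) (W i)) (R₀ : KIdx 2 ℓ hd3 hL b₀ b₁ → ℝ)
    (H₀ : KIdx 2 ℓ hd3 hL b₀ b₁ → Prop) (c35 a₁ M₁ B₃ δ₃ : ℝ) :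
    LettersRowT3 𝔬 R₀ H₀ c35 a₁ M₁ B₃ δ₃ ↔
      ∀ i : KIdx 2 ℓ hd3 hL b₀ b₁, M₁ ≤ (geo9K i).M → ∀ α₀ : ℝ, 0 < α₀ → (geo9K i).M * α₀ ≤ a₁ →
        ∀ U : (bgT3 i).Cfg, (bgT3 i).Reg335 c35 α₀ U → (bgT3 i).Reg336 c35 α₀ U →
          Letters313 (𝔬 i) (R₀ i) (H₀ i) (geoOK_geo9K i) B₃ δ₃ U :=
  Iff.rfl

/-- **THE ROW IS THE `hletters` BINDER OF `t313_of_pins_T3`** (projection; so (S3-b) binds one name). [cite: Balaban1985BackgroundPropagators, Thm 3.13 p.426] -/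
theorem t313_hletters_of_row {𝔬 : ∀ i : KIdx 2 ℓ hd3 hL b₀ b₁, Ops (geo9K i) (bgT3 i) (X i) (Y i) (Z i) (W i)} {R₀ : KIdx 2 ℓ hd3 hL b₀ b₁ → ℝ}
    {H₀ : KIdx 2 ℓ hd3 hL b₀ b₁ → Prop} {c35 a₁ M₁ B₃ δ₃ : ℝ} (h : LettersRowT3 𝔬 R₀ H₀ c35 a₁ M₁ B₃ δ₃)
    (i : KIdx 2 ℓ hd3 hL b₀ b₁) (hM : M₁ ≤ (geo9K i).M) (α₀ : ℝ) (hα₀ : 0 < α₀) (hMa : (geo9K i).M * α₀ ≤ a₁)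
    (U : (bgT3 i).Cfg) (hU : (bgT3 i).Reg335 c35 α₀ U) (hU' : (bgT3 i).Reg336 c35 α₀ U) :
    Letters313 (𝔬 i) (R₀ i) (H₀ i) (geoOK_geo9K i) B₃ δ₃ U :=
  h i hM α₀ hα₀ hMa U hU hU'

end Summit.QuantumFields.YangMills.Theorems.Prop7SectET3Letters

end
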